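import Summits.Ventures.PercRepro.GenQHyperplaneRises
import Summits.Ventures.PercRepro.GenQHyperplaneCount
import Summits.Ventures.PercRepro.GenQBasesCount

/-!
# PercRepro — the hyperplane-trace block of the profile LP, as rows (night-4, gen 8; part A: the identities)

The identities (H1) `sum_mTr_level_eq_sum_hyperplanes`, (H5) `sum_rises_eq_sum_hyperplanes`, (H2)
`card_rank_subsets_eq_sum_spF` and the bound (H4) `one_add_two_mul_le_card_basesOf` are stated per hyperplane
`H ∈ flatsQ M (q − 1)`.  The LP works with the PER-SIZE aggregates
`h_s = #{H : |H ∩ G| = s, H ∩ G spans H}` (`hypTr`) and `SP_{s,j} = Σ_{H : |H ∩ G| = s} #{T ⊆ H ∩ G : |T| = j, rk T = q − 1}`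
(`spSum`); this file regroups the identities by trace size so that a certificate of the LP can quote them verbatim
(the generator's facts): `h1_row`, `h5_row` / `h5_row_mv`, `h2_row` / `h2_row_le`, `spSum_le_choose_mul_hypTr` (H3),
`h4_row` (H4), and the zero rows (`s < r`, `s < j`, `s = |G|`, `s` beyond the flat bound).  A trace that does not span its
hyperplane carries no rank-`(q − 1)` subset (`spF_eq_zero_of_eRk_ne`), so the sums over all hyperplanes are sums over
the spanning traces.  Part B (`GenQHyperplaneRowsB`) is the pencil cap (P0).
-/
namespace PercRepro.Night4

open Finset ThmH SixFour GenQ PerFlat Star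

variable {α : Type*} [DecidableEq α] {M : Matroid α} [M.Finite]

/-- The rank-`r` flats whose trace on `G` has `s` points and spans the flat. -/
noncomputable def flatsTr (M : Matroid α) [M.Finite] (G : Finset α) (r s : ℕ) : Finset (Finset α) :=
  (flatsQ M r).filter (fun H : Finset α => (H ∩ G).card = s ∧ M.eRk ((H ∩ G : Finset α) : Set α) = (r : ℕ∞))

/-- `h_s`: the number of rank-`r` flats with an `s`-point spanning trace on `G`. -/
noncomputable def hypTr (M : Matroid α) [M.Finite] (G : Finset α) (r s : ℕ) : ℕ := (flatsTr M G r s).card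

/-- `SP_{s,j}`: the rank-`r` `j`-subsets of the `s`-point spanning traces. -/
noncomputable def spSum (M : Matroid α) [M.Finite] (G : Finset α) (r s j : ℕ) : ℕ :=
  ∑ H ∈ flatsTr M G r s, spF M G H r j

/-- A trace of rank `< r` has no rank-`r` subset. -/
theorem spF_eq_zero_of_eRk_ne {G H : Finset α} {r j : ℕ}
    (h : M.eRk ((H ∩ G : Finset α) : Set α) ≠ (r : ℕ∞)) (hle : M.eRk ((H ∩ G : Finset α) : Set α) ≤ (r : ℕ∞)) :
    spF M G H r j = 0 := by
  unfold spF
  rw [Finset.card_eq_zero, Finset.filter_eq_empty_iff]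
  intro T hT hTr
  rw [Finset.mem_powersetCard] at hT
  have hmono : M.eRk (T : Set α) ≤ M.eRk ((H ∩ G : Finset α) : Set α) :=
    M.eRk_mono (by exact_mod_cast hT.1)
  rw [hTr] at hmono
  exact h (le_antisymm hle hmono)

/-- The trace of a rank-`r` flat has rank `≤ r`. -/
theorem eRk_inter_le_of_flatsQ {G H : Finset α} {r : ℕ} (hH : H ∈ flatsQ M r) :
    M.eRk ((H ∩ G : Finset α) : Set α) ≤ (r : ℕ∞) := by
  have hHr : M.eRk (H : Set α) = (r : ℕ∞) := (mem_flatsQ.1 hH).2.2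
  rw [← hHr]
  exact M.eRk_mono (by intro x hx; simp only [Finset.coe_inter, Set.mem_inter_iff] at hx; exact_mod_cast hx.1)

/-- (H3) `SP_{s,j} ≤ C(s, j) · h_s`. -/
theorem spSum_le_choose_mul_hypTr (G : Finset α) (r s j : ℕ) :
    spSum M G r s j ≤ s.choose j * hypTr M G r s := by
  unfold spSum hypTr
  rw [Finset.card_eq_sum_ones, Finset.mul_sum, mul_one]
  refine Finset.sum_le_sum (fun H hH => ?_)
  have hs : (H ∩ G).card = s := ((Finset.mem_filter.1 hH).2).1
  unfold spF
  calc (((H ∩ G).powersetCard j).filter (fun T : Finset α => M.eRk (T : Set α) = (r : ℕ∞))).card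
      ≤ ((H ∩ G).powersetCard j).card := Finset.card_filter_le _ _
    _ = s.choose j := by rw [Finset.card_powersetCard, hs]

/-- Regrouping a sum over the rank-`r` flats weighted by a function of the trace size, through the spanning traces. -/
theorem sum_flatsQ_spF_eq_sum_spSum (G : Finset α) (r j : ℕ) (g : ℕ → ℕ) :
    ∑ H ∈ flatsQ M r, g (H ∩ G).card * spF M G H r j
      = ∑ s ∈ Finset.range (G.card + 1), g s * spSum M G r s j := by
  classical
  -- drop the non-spanning traces (their `spF` vanishes), then fiber by the trace size
  have h1 : ∑ H ∈ flatsQ M r, g (H ∩ G).card * spF M G H r j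
      = ∑ H ∈ (flatsQ M r).filter (fun H : Finset α => M.eRk ((H ∩ G : Finset α) : Set α) = (r : ℕ∞)),
          g (H ∩ G).card * spF M G H r j := by
    rw [Finset.sum_filter]
    refine Finset.sum_congr rfl (fun H hH => ?_)
    split_ifs with hsp
    · rfl
    · rw [spF_eq_zero_of_eRk_ne hsp (eRk_inter_le_of_flatsQ hH), mul_zero]
  rw [h1, ← Finset.sum_fiberwise_of_maps_to (s := (flatsQ M r).filter
        (fun H : Finset α => M.eRk ((H ∩ G : Finset α) : Set α) = (r : ℕ∞)))
        (t := Finset.range (G.card + 1)) (g := fun H : Finset α => (H ∩ G).card)]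
  · refine Finset.sum_congr rfl (fun s _ => ?_)
    unfold spSum flatsTr
    rw [Finset.mul_sum]
    have hfe : ((flatsQ M r).filter (fun H : Finset α => M.eRk ((H ∩ G : Finset α) : Set α) = (r : ℕ∞))).filter
        (fun H : Finset α => (H ∩ G).card = s)
        = (flatsQ M r).filter (fun H : Finset α => (H ∩ G).card = s ∧ M.eRk ((H ∩ G : Finset α) : Set α) = (r : ℕ∞)) := by
      ext H
      simp only [Finset.mem_filter]
      tauto
    rw [hfe]
    refine Finset.sum_congr rfl (fun H hH => ?_)
    have hs : (H ∩ G).card = s := ((Finset.mem_filter.1 hH).2).1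
    rw [hs]
  · intro H _
    rw [Finset.mem_range]
    exact Nat.lt_succ_of_le (Finset.card_le_card (Finset.inter_subset_right))

/-- The level-`k` sets partitioned by their coloop count: `Σ_{S ∈ levelSets k} m(S) = Σ_m m · #Pc k m`. -/
theorem sum_mTr_level_eq_sum_Pc {G : Finset α} {q k : ℕ} (hG : G ⊆ gr M)
    (hrG : M.eRk (G : Set α) = (q : ℕ∞)) :
    ∑ S ∈ levelSets M G q k, mTr M S = ∑ m ∈ Finset.Icc (mTr M G) q, m * (Pc M G q k m).card := by
  classical
  rw [← Finset.sum_fiberwise_of_maps_to (s := levelSets M G q k) (t := Finset.Icc (mTr M G) q)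
        (g := fun S : Finset α => mTr M S)]
  · refine Finset.sum_congr rfl (fun m _ => ?_)
    have hfe : (levelSets M G q k).filter (fun S : Finset α => mTr M S = m) = Pc M G q k m := by
      ext S
      rw [Finset.mem_filter, mem_levelSets, mem_Pc]
      tauto
    rw [hfe, Finset.card_eq_sum_ones, Finset.mul_sum, mul_one]
    refine Finset.sum_congr rfl (fun S hS => ?_)
    exact ((mem_Pc.1 hS).2).2
  · intro S hS
    have hS' := (mem_levelSets.1 hS).1
    rw [Finset.mem_Icc]
    refine ⟨mTr_le_of_mem_Rq hG hrG hS', ?_⟩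
    have hSG : S ⊆ G := (mem_Rq.1 hS').1
    exact mTr_le_of_eRk_eq (hSG.trans hG) (mem_Rq.1 hS').2

/-- `|G ∖ H| = |G| − |H ∩ G|`. -/
theorem card_sdiff_eq_card_sub_card_inter (G H : Finset α) : (G \ H).card = G.card - (H ∩ G).card := by
  rw [Finset.inter_comm]
  have h := Finset.card_sdiff_add_card_inter G H
  omega

/-- **(H1) as an LP row**: `Σ_m m · #Pc k m = Σ_s (n − s) · SP_{s, n−k−1}` (`n = |G|`), the sum over all trace sizes
`s ≤ n` (the terms with `s < q − 1` or `s < n − k − 1` vanish). -/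
theorem h1_row {G : Finset α} {q k : ℕ} (hG : G ⊆ gr M) (hrG : M.eRk (G : Set α) = (q : ℕ∞))
    (hq : 1 ≤ q) (hk : k + 1 ≤ G.card) :
    ∑ m ∈ Finset.Icc (mTr M G) q, m * (Pc M G q k m).card
      = ∑ s ∈ Finset.range (G.card + 1), (G.card - s) * spSum M G (q - 1) s (G.card - k - 1) := by
  rw [← sum_mTr_level_eq_sum_Pc hG hrG, sum_mTr_level_eq_sum_hyperplanes hG hq hk,
    ← sum_flatsQ_spF_eq_sum_spSum G (q - 1) (G.card - k - 1) (fun s => G.card - s)]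
  refine Finset.sum_congr rfl (fun H _ => ?_)
  rw [card_sdiff_eq_card_sub_card_inter]

/-- **(H5) as an LP row**: the rises out of level `k` — `Σ_{S ∈ levelSets k} Σ_{y ∈ G ∖ S} (m(S) − m(S ∪ y))
= Σ_s (n − s)(n − s − 1) · SP_{s, n−k−1}`. -/
theorem h5_row {G : Finset α} {q k : ℕ} (hG : G ⊆ gr M) (hrG : M.eRk (G : Set α) = (q : ℕ∞))
    (hq : 1 ≤ q) (hk : k + 1 ≤ G.card) :
    ∑ S ∈ levelSets M G q k, ∑ y ∈ G \ S, (mTr M S - mTr M (insert y S))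
      = ∑ s ∈ Finset.range (G.card + 1), (G.card - s) * (G.card - s - 1) * spSum M G (q - 1) s (G.card - k - 1) := by
  rw [sum_rises_eq_sum_hyperplanes hG hrG hq hk,
    ← sum_flatsQ_spF_eq_sum_spSum G (q - 1) (G.card - k - 1) (fun s => (G.card - s) * (G.card - s - 1))]
  refine Finset.sum_congr rfl (fun H _ => ?_)
  rw [card_sdiff_eq_card_sub_card_inter]

/-- **(H2) as an LP row**: the rank-`r` `j`-subsets of `G` number `Σ_s SP_{s,j}`. -/
theorem h2_row {G : Finset α} (hG : G ⊆ gr M) (r j : ℕ) :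
    ((G.powersetCard j).filter (fun T : Finset α => M.eRk (T : Set α) = (r : ℕ∞))).card
      = ∑ s ∈ Finset.range (G.card + 1), spSum M G r s j := by
  rw [card_rank_subsets_eq_sum_spF hG r j]
  have h := sum_flatsQ_spF_eq_sum_spSum (M := M) G r j (fun _ => 1)
  simpa only [one_mul] using h

/-- **(H4) as an LP row**: `(1 + 2(s − r)) · h_s ≤ SP_{s,r}` — every `s`-point spanning trace of a rank-`r` flat
(`r ≥ 1`) of a simple matroid has `≥ 1 + 2(s − r)` bases. -/
theorem h4_row (hs : Simple M) {G : Finset α} (hG : G ⊆ gr M) {r : ℕ} (hr1 : 1 ≤ r) (s : ℕ) :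
    (1 + 2 * (s - r)) * hypTr M G r s ≤ spSum M G r s r := by
  unfold hypTr spSum
  rw [Finset.card_eq_sum_ones, Finset.mul_sum, mul_one]
  refine Finset.sum_le_sum (fun H hH => ?_)
  have hH' := Finset.mem_filter.1 hH
  have hsc : (H ∩ G).card = s := hH'.2.1
  have hX : H ∩ G ⊆ gr M := Finset.inter_subset_right.trans hG
  have h := one_add_two_mul_le_card_basesOf hs hX hr1 hH'.2.2
  rw [hsc] at h
  exact h

/-- `SP_{s,j} = 0` when `s < r` (a spanning trace of a rank-`r` flat has `≥ r` points). -/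
theorem spSum_eq_zero_of_lt_rank (G : Finset α) {r s : ℕ} (hsr : s < r) (j : ℕ) : spSum M G r s j = 0 := by
  unfold spSum
  refine Finset.sum_eq_zero (fun H hH => ?_)
  have hH' := Finset.mem_filter.1 hH
  exfalso
  have h1 : M.eRk ((H ∩ G : Finset α) : Set α) ≤ ((H ∩ G).card : ℕ∞) := by
    have := M.eRk_le_encard ((H ∩ G : Finset α) : Set α)
    rwa [Set.encard_coe_eq_coe_finsetCard] at this
  rw [hH'.2.2, hH'.2.1] at h1
  have h2 : r ≤ s := by exact_mod_cast h1
  omega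

/-- `SP_{s,j} = 0` when `s < j` (no `j`-subsets). -/
theorem spSum_eq_zero_of_lt (G : Finset α) (r : ℕ) {s j : ℕ} (hsj : s < j) : spSum M G r s j = 0 := by
  unfold spSum
  refine Finset.sum_eq_zero (fun H hH => ?_)
  have hsc : (H ∩ G).card = s := (Finset.mem_filter.1 hH).2.1
  unfold spF
  rw [Finset.card_eq_zero, Finset.filter_eq_empty_iff]
  intro T hT
  rw [Finset.mem_powersetCard] at hT
  exfalso
  have := Finset.card_le_card hT.1
  omega

/-- `h_n = 0` and `SP_{n,j} = 0` at `s = |G|` when `G` has rank `≠ r` (the trace would be all of `G`). -/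
theorem flatsTr_card_eq_empty {G : Finset α} {q r : ℕ} (hrG : M.eRk (G : Set α) = (q : ℕ∞)) (hqr : q ≠ r) :
    flatsTr M G r G.card = ∅ := by
  unfold flatsTr
  rw [Finset.filter_eq_empty_iff]
  intro H _ hH
  have heq : H ∩ G = G := Finset.eq_of_subset_of_card_le Finset.inter_subset_right (by rw [hH.1])
  rw [heq, hrG] at hH
  exact hqr (by exact_mod_cast hH.2)

/-- `h_n = 0`: no trace of size `|G|` when `rk G ≠ r`. -/
theorem hypTr_card_eq_zero {G : Finset α} {q r : ℕ} (hrG : M.eRk (G : Set α) = (q : ℕ∞)) (hqr : q ≠ r) :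
    hypTr M G r G.card = 0 := by
  unfold hypTr; rw [flatsTr_card_eq_empty hrG hqr]; rfl

/-- `SP_{n,j} = 0`: no trace of size `|G|` when `rk G ≠ r`. -/
theorem spSum_card_eq_zero {G : Finset α} {q r : ℕ} (hrG : M.eRk (G : Set α) = (q : ℕ∞)) (hqr : q ≠ r) (j : ℕ) :
    spSum M G r G.card j = 0 := by
  unfold spSum; rw [flatsTr_card_eq_empty hrG hqr]; rfl

/-- The rises out of level `k + 1`, regrouped by the classes: `Σ_{S ∈ levelSets (k+1)} Σ_{y ∈ G ∖ S} (m(S) − m(S ∪ y))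
= Σ_{m' ∈ [m(G), q]} Σ_{m ∈ [m(G), m']} (m' − m) · mv k m' m`. -/
theorem sum_rises_eq_sum_mv {G : Finset α} {q k : ℕ} (hG : G ⊆ gr M) (hrG : M.eRk (G : Set α) = (q : ℕ∞)) :
    ∑ S ∈ levelSets M G q (k + 1), ∑ y ∈ G \ S, (mTr M S - mTr M (insert y S))
      = ∑ m' ∈ Finset.Icc (mTr M G) q, ∑ m ∈ Finset.Icc (mTr M G) m', (m' - m) * mv M G q k m' m := by
  classical
  -- fiber the level by `m(S) = m'`
  rw [← Finset.sum_fiberwise_of_maps_to (s := levelSets M G q (k + 1)) (t := Finset.Icc (mTr M G) q)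
        (g := fun S : Finset α => mTr M S)]
  · refine Finset.sum_congr rfl (fun m' hm' => ?_)
    have hfe : (levelSets M G q (k + 1)).filter (fun S : Finset α => mTr M S = m') = Pc M G q (k + 1) m' := by
      ext S
      rw [Finset.mem_filter, mem_levelSets, mem_Pc]
      tauto
    rw [hfe]
    unfold mv
    simp_rw [Finset.mul_sum]
    rw [Finset.sum_comm]
    refine Finset.sum_congr rfl (fun S hS => ?_)
    have hS' := mem_Pc.1 hS
    -- fiber the points `y ∈ G ∖ S` by `m(S ∪ y) = m`
    rw [← Finset.sum_fiberwise_of_maps_to (s := G \ S) (t := Finset.Icc (mTr M G) m')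
          (g := fun y => mTr M (insert y S))]
    · refine Finset.sum_congr rfl (fun m _ => ?_)
      rw [Finset.card_eq_sum_ones, Finset.mul_sum, mul_one]
      refine Finset.sum_congr rfl (fun y hy => ?_)
      rw [hS'.2.2, (Finset.mem_filter.1 hy).2]
    · intro y hy
      rw [Finset.mem_Icc]
      have hyG : y ∈ G := (Finset.mem_sdiff.1 hy).1
      have hins : insert y S ∈ Rq M G q := insert_mem_Rq hrG hS'.1 hyG
      refine ⟨mTr_le_of_mem_Rq hG hrG hins, ?_⟩
      rw [← hS'.2.2]
      exact mTr_insert_le_of_mem_Rq hG hrG hS'.1 hyG (Finset.mem_sdiff.1 hy).2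
  · intro S hS
    have hS' := (mem_levelSets.1 hS).1
    rw [Finset.mem_Icc]
    refine ⟨mTr_le_of_mem_Rq hG hrG hS', ?_⟩
    have hSG : S ⊆ G := (mem_Rq.1 hS').1
    exact mTr_le_of_eRk_eq (hSG.trans hG) (mem_Rq.1 hS').2

/-- **(H5) as an LP row in the `mv` variables**: `Σ_{m',m} (m' − m) · mv k m' m = Σ_s (n − s)(n − s − 1) · SP_{s, n−k−2}`. -/
theorem h5_row_mv {G : Finset α} {q k : ℕ} (hG : G ⊆ gr M) (hrG : M.eRk (G : Set α) = (q : ℕ∞))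
    (hq : 1 ≤ q) (hk : k + 2 ≤ G.card) :
    ∑ m' ∈ Finset.Icc (mTr M G) q, ∑ m ∈ Finset.Icc (mTr M G) m', (m' - m) * mv M G q k m' m
      = ∑ s ∈ Finset.range (G.card + 1), (G.card - s) * (G.card - s - 1) * spSum M G (q - 1) s (G.card - (k + 1) - 1) := by
  rw [← sum_rises_eq_sum_mv hG hrG]
  exact h5_row hG hrG hq (by omega)

/-- **(H2) as an LP row**: the rank-`(q−1)` `j`-subsets and the spanning `j`-subsets of `G` are disjoint families of
`j`-subsets: `Σ_s SP_{s,j} + Σ_m #Pc (n − j) m ≤ C(n, j)` (`q ≥ 1`). -/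
theorem h2_row_le {G : Finset α} {q : ℕ} (hG : G ⊆ gr M) (hrG : M.eRk (G : Set α) = (q : ℕ∞)) (hq : 1 ≤ q)
    {j : ℕ} (hj : j ≤ G.card) :
    ∑ s ∈ Finset.range (G.card + 1), spSum M G (q - 1) s j
      + ∑ m ∈ Finset.Icc (mTr M G) q, (Pc M G q (G.card - j) m).card ≤ G.card.choose j := by
  classical
  rw [← h2_row hG (q - 1) j]
  -- the spanning `j`-subsets are the level `n − j`
  have hlev : ∑ m ∈ Finset.Icc (mTr M G) q, (Pc M G q (G.card - j) m).card
      = ((G.powersetCard j).filter (fun T : Finset α => M.eRk (T : Set α) = (q : ℕ∞))).card := by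
    rw [Finset.card_eq_sum_card_fiberwise (s := (G.powersetCard j).filter (fun T : Finset α => M.eRk (T : Set α) = (q : ℕ∞)))
      (t := Finset.Icc (mTr M G) q) (f := fun T => mTr M T)]
    · refine Finset.sum_congr rfl (fun m _ => ?_)
      congr 1
      ext T
      simp only [Finset.mem_filter, Finset.mem_powersetCard, mem_Pc, mem_Rq]
      constructor
      · rintro ⟨⟨hTG, hTr⟩, hcd, hm⟩
        refine ⟨⟨⟨hTG, ?_⟩, hTr⟩, hm⟩
        rw [card_sdiff_eq_card_sub_card_inter, Finset.inter_eq_left.2 hTG] at hcd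
        have h2 := Finset.card_le_card hTG
        omega
      · rintro ⟨⟨⟨hTG, hTj⟩, hTr⟩, hm⟩
        refine ⟨⟨hTG, hTr⟩, ?_, hm⟩
        rw [card_sdiff_eq_card_sub_card_inter, Finset.inter_eq_left.2 hTG, hTj]
    · intro T hT
      rw [Finset.mem_coe, Finset.mem_filter, Finset.mem_powersetCard] at hT
      rw [Finset.mem_coe, Finset.mem_Icc]
      have hTR : T ∈ Rq M G q := mem_Rq.2 ⟨hT.1.1, hT.2⟩
      exact ⟨mTr_le_of_mem_Rq hG hrG hTR, mTr_le_of_eRk_eq (hT.1.1.trans hG) hT.2⟩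
  rw [hlev, ← Finset.card_union_of_disjoint]
  · calc (((G.powersetCard j).filter (fun T : Finset α => M.eRk (T : Set α) = ((q - 1 : ℕ) : ℕ∞))) ∪
          ((G.powersetCard j).filter (fun T : Finset α => M.eRk (T : Set α) = (q : ℕ∞)))).card
        ≤ (G.powersetCard j).card := by
          apply Finset.card_le_card
          intro T hT
          rw [Finset.mem_union, Finset.mem_filter, Finset.mem_filter] at hT
          rcases hT with hT | hT <;> exact hT.1
      _ = G.card.choose j := Finset.card_powersetCard _ _
  · rw [Finset.disjoint_left]
    intro T h1 h2
    rw [Finset.mem_filter] at h1 h2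
    have := h1.2.symm.trans h2.2
    have h' : q - 1 = q := by exact_mod_cast this
    omega

/-- `h_s = 0` and `SP_{s,j} = 0` beyond the flat bound: a rank-`r` flat with `≤ B` points has no `s`-point trace for `s > B`. -/
theorem flatsTr_eq_empty_of_flat_le {G : Finset α} {r B s : ℕ} (hflat : ∀ F ∈ flatsQ M r, F.card ≤ B) (hBs : B < s) :
    flatsTr M G r s = ∅ := by
  unfold flatsTr
  rw [Finset.filter_eq_empty_iff]
  intro H hH h
  have h1 := hflat H hH
  have h2 : (H ∩ G).card ≤ H.card := Finset.card_le_card Finset.inter_subset_left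
  omega

/-- `SP_{s,j} = 0` beyond the flat bound `B < s`. -/
theorem spSum_eq_zero_of_flat_le {G : Finset α} {r B s : ℕ} (hflat : ∀ F ∈ flatsQ M r, F.card ≤ B) (hBs : B < s) (j : ℕ) :
    spSum M G r s j = 0 := by
  unfold spSum; rw [flatsTr_eq_empty_of_flat_le hflat hBs]; rfl

/-- `h_s = 0` beyond the flat bound `B < s`. -/
theorem hypTr_eq_zero_of_flat_le {G : Finset α} {r B s : ℕ} (hflat : ∀ F ∈ flatsQ M r, F.card ≤ B) (hBs : B < s) :
    hypTr M G r s = 0 := by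
  unfold hypTr; rw [flatsTr_eq_empty_of_flat_le hflat hBs]; rfl

end PercRepro.Night4
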